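import Mathlib.LinearAlgebra.Eigenspace.Basic
import Mathlib.LinearAlgebra.Matrix.ToLin
import Mathlib.LinearAlgebra.Projection
import Mathlib.RingTheory.Artinian.Module
import Mathlib.GroupTheory.OrderOfElement
import Mathlib.RepresentationTheory.Homological.GroupCohomology.LowDegree
import Literature.NumberTheory.GaloisRepresentations.EnormousSubgroup
import Literature.NumberTheory.GaloisRepresentations.ContinuousRep
import HarnessLib

/-!
# Adequate subgroups of `GL_n(k)` (Thorne 2012, Def. 2.3; Guralnick–Herzig–Taylor–Thorne)

Topic `NumberTheory/GaloisRepresentations`.  Let `k` be a field of characteristic `p` and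
`H ≤ GL_n(k) = GL(V)`, `V = kⁿ`, a subgroup; `ad V = M_{n×n}(k)` with the adjoint (conjugation)
action and `ad⁰ V ⊆ ad V` the trace-zero matrices (the tree's `glAdjointRepresentation`, `adZero`,
`Subgroup.adZeroRep` from `EnormousSubgroup`).  Thorne, *On the automorphy of `l`-adic Galois
representations with small residual image*, J. Inst. Math. Jussieu 11 (2012), Def. 2.3 (arXiv
p. 6), as printed ("`k` a finite field of characteristic `l`", "`G` … acts absolutely irreducibly",
"we assume that `k` is large enough to contain all eigenvalues of all elements of `G`. If `g ∈ G`
and `α ∈ k` is an eigenvalue of `g`, then we write `e_{g,α} : V → V` for the `g`-equivariant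
projection to the generalized `α`-eigenspace"):

> Definition 2.3. Let `G ⊂ GL(V)` be as above. We say that `G` is *adequate* if the following
> conditions are satisfied.  • `H⁰(G, ad⁰ V) = 0`.  • `H¹(G, k) = 0`.  • `H¹(G, ad⁰ V) = 0`.
> • For every irreducible `k[G]`-submodule `W ⊂ ad⁰ V`, there exists an element `g ∈ G` with an
> eigenvalue `α` such that `tr e_{g,α} W ≠ 0`.

("Thus the only difference between 'adequate' and 'big' is that we no longer require the
eigenvalue `α` to have multiplicity one.")  The appendix by Guralnick–Herzig–Taylor–Thorne
(arXiv:1107.5993, Lemma 1) shows, for `Γ ⊂ GL_n(𝔽̄_l)` finite acting irreducibly, that the last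
condition is equivalent to the same condition with `g` **semisimple** ("i.e. of order prime to
`l`"; because `e_{g,α} = e_{g_s,α}` and `g_s` is a power of `g`), and to "the set `Γ^ss` spans
`ad V`"; Guralnick–Herzig–Tiep (JEMS 2017, §1) restate adequacy in that amended form.  The
definition requested (item `defn-ThorneAdequate`, for route `TrigonalHeartLimit`'s support item
*HeartAdequate*: is `A₆ ≅ Ω₄⁻(3) < GL₄(𝔽̄₃)` adequate at `p = 3`?) is Def. 2.3 with the last clause
in the semisimple form.

## Main definitions

* `eigenprojection f α : Module.End K V` — **`e_{f,α}`**, the projection of a finite-dimensional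
  `V` onto the generalised `α`-eigenspace `⋃ₘ ker (f − α)ᵐ` (Mathlib `Module.End.maxGenEigenspace`)
  along the Fitting complement `⋂ₘ range (f − α)ᵐ` (Mathlib `LinearMap.isCompl_iSup_ker_pow_iInf_range_pow`,
  `Submodule.projection`); it commutes with `f` (`eigenprojection_mul_comm`), which characterises
  it as THE `f`-equivariant projection onto the generalised eigenspace (an `f`-stable complement of
  `⋃ₘ ker (f − α)ᵐ` is unique, `f − α` being invertible on the quotient).  It is non-zero iff
  `α` is an eigenvalue of `f` (`eigenprojection_ne_zero_iff`, Mathlib `Module.End.HasEigenvalue`).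
  On eigenvectors: `e_{f,α} v = v` if `f v = α v` and `e_{f,α} v = 0` if `f v = β v`, `β ≠ α`
  (`eigenprojection_apply_of_apply_eq_smul`, `…_of_ne`), which computes `e_{f,α}` on an eigenbasis
  of a diagonalisable `f`.  `eigenprojectionMatrix A α` — the same for a square matrix `A` acting
  on `ι → K` (Mathlib `Matrix.toLin'` / `LinearMap.toMatrix'`).
* `Subgroup.IsThorneAdequate H` — **`H ≤ GL_n(k)` is adequate** (Def. 2.3, clauses verbatim, the
  last one in the GHTT semisimple form): (i) `H¹(H, k) = 0` for the trivial action, i.e. every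
  additive homomorphism `H → k` is zero (Mathlib `groupCohomology.H1IsoOfIsTrivial`:
  `H¹(G, A) ≅ Hom(G, A)` for trivial `A`; see `IsThorneAdequate.subsingleton_H1_trivial`);
  (ii) `H⁰(H, ad⁰) = (ad⁰)^H = 0` (Mathlib `Representation.invariants`); (iii) `H¹(H, ad⁰) = 0`:
  every inhomogeneous `1`-cocycle `H → ad⁰` is a `1`-coboundary (Mathlib
  `groupCohomology.cocycles₁ ≤ coboundaries₁`, i.e. `H¹ = 0`, see `IsThorneAdequate.subsingleton_H1`);
  (iv) for every simple `k[H]`-submodule `W ⊆ ad⁰` (an atom of the lattice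
  `Subrepresentation (adZeroRep H)`) there are `h ∈ H` of order prime to `p = ringChar k`,
  `α ∈ k` and `w ∈ W` with `tr(e_{h,α} w) ≠ 0` (then `α` is automatically an eigenvalue of `h`,
  since otherwise `e_{h,α} = 0`: `hasEigenvalue_of_trace_eigenprojectionMatrix_mul_ne_zero`).
* `FramedRep.HasAdequateImage ρ` — dot-form for a framed representation `ρ : G →ₜ* GL_n(k)`: the
  image `ρ(G) ≤ GL_n(k)` is adequate (Thorne's hypothesis "`ρ̄(G_{F(ζ_l)}) ⊂ GL_n(k)` is adequate",
  Thms. 7.1, 9.1, 10.1, 10.2, is `HasAdequateImage` of the restriction of `ρ̄` to `G_{F(ζ_l)}`).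
* API: unfolding lemmas; `H¹` statements in Mathlib's `groupCohomology.H1`; the remark that for
  `p ∣ n`, `n ≥ 1`, no subgroup of `GL_n(k)` is adequate in this sense (`ad⁰` contains the scalars,
  contradicting (ii); this is why Guralnick–Herzig–Tiep list "`p` does not divide `dim V`" as the
  first condition of Thorne's 2012 notion) — `Subgroup.not_isThorneAdequate_of_natCast_eq_zero`;
  a checkable form of "order prime to `p`" (`coprime_orderOf_of_pow_eq_one`).

## Design

* As for `Subgroup.IsEnormous`, absolute irreducibility of `H` (Thorne: "`G` … acts absolutely
  irreducibly") is the standing hypothesis of §2, not a clause of Def. 2.3, and is NOT built in;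
  statements wanting Thorne's sentence literally add `IsAbsIrreducible` next to it (Thorne's own
  theorems list "`ρ̄` is absolutely irreducible and `ρ̄(G_{F(ζ_l)})` is adequate" as two hypotheses).
* "Semisimple" is taken in the printed GHTT sense "of order prime to `l`":
  `(orderOf h).Coprime (ringChar k)` (so `h` has finite order; for a finite-order element of
  `GL_n(k)`, `char k = p`, this is equivalent to diagonalisability over `k̄`).  Intended for
  `ringChar k = p` prime; in characteristic `0` the clause degenerates (only `h = 1` qualifies), as
  does the whole notion.
* Def. 2.3 is stated over a `k` containing the eigenvalues of all elements of `H`; over a smaller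
  `k` clause (iv) (with `α ∈ k`) is more restrictive.  Users take `k = 𝔽̄_p` or a sufficiently
  large finite field, as Thorne and GHTT do ("for any finite subfield `k` of `𝔽̄_l` containing the
  eigenvalues of all elements of `Γ` … `Γ` is adequate", GHTT after Thm. 9).
* NOT here (each a separate result, none needed to STATE the notion): GHTT Lemma 1 (equivalence of
  (iv) with "`H^ss` spans `M_n(k)`", Guralnick's *weak adequacy*), Lemma 2.4 / GHTT Thm. 9
  (`p ≥ 2(n+1)` and absolutely irreducible ⇒ adequate), "big ⇒ adequate", and the extended notion
  of Thorne's later papers allowing `p ∣ n` (GHT 2017, §1: `H¹(H,k) = 0`, `H¹(H, ad/k) = 0`,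
  span condition).

## References

* [Thorne2012] J. Thorne, *On the automorphy of `l`-adic Galois representations with small residual
  image*, J. Inst. Math. Jussieu 11 (2012) 855–920, §2, Def. 2.3, Lemma 2.4; Thms. 7.1, 9.1, 10.1,
  10.2 (held: arXiv:1107.5989, pp. 6, 24, 31–33); appendix *Adequate subgroups* by R. Guralnick,
  F. Herzig, R. Taylor, J. Thorne, Lemma 1, Lemma 2, Thm. 9 (held: arXiv:1107.5993, pp. 1, 6–7).
* [GuralnickHerzigTiep2017] R. Guralnick, F. Herzig, P. H. Tiep, *Adequate subgroups and
  indecomposable modules*, JEMS 19 (2017), §1 (held: arXiv:1405.0043, p. 3).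
-/

noncomputable section

open scoped MatrixGroups

namespace Literature.NumberTheory.GaloisRepresentations

universe u

/-! ### The equivariant projection `e_{f,α}` onto a generalised eigenspace -/

section Eigenprojection

variable {K : Type*} [Field K] {V : Type*} [AddCommGroup V] [Module K V] [FiniteDimensional K V]

/-- Fitting decomposition of `V` with respect to `f − α`: the generalised `α`-eigenspace
`⋃ₘ ker (f − α)ᵐ` and `⋂ₘ range (f − α)ᵐ` are complementary (Mathlib
`LinearMap.isCompl_iSup_ker_pow_iInf_range_pow`). [folklore] -/
theorem isCompl_iSup_ker_iInf_range (f : Module.End K V) (α : K) :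
    IsCompl (⨆ m : ℕ, LinearMap.ker ((f - α • 1) ^ m))
      (⨅ m : ℕ, LinearMap.range ((f - α • 1) ^ m)) :=
  LinearMap.isCompl_iSup_ker_pow_iInf_range_pow _

omit [FiniteDimensional K V] in
/-- The generalised `α`-eigenspace in the Fitting form `⋃ₘ ker (f − α)ᵐ` is Mathlib's
`Module.End.maxGenEigenspace f α`. [folklore] -/
theorem iSup_ker_pow_eq_maxGenEigenspace (f : Module.End K V) (α : K) :
    (⨆ m : ℕ, LinearMap.ker ((f - α • 1) ^ m)) = f.maxGenEigenspace α := by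
  rw [← Module.End.iSup_genEigenspace_eq]
  simp_rw [Module.End.genEigenspace_nat]

/-- **`e_{f,α}`**: "the `f`-equivariant projection to the generalized `α`-eigenspace" of an
endomorphism `f` of a finite-dimensional vector space `V` — the projection onto
`⋃ₘ ker (f − α)ᵐ` along the (unique `f`-stable) complement `⋂ₘ range (f − α)ᵐ`.
[cite: Thorne2012, §2 (before Def. 2.1)] -/
def eigenprojection (f : Module.End K V) (α : K) : Module.End K V :=
  (⨆ m : ℕ, LinearMap.ker ((f - α • 1) ^ m)).projection
    (⨅ m : ℕ, LinearMap.range ((f - α • 1) ^ m)) (isCompl_iSup_ker_iInf_range f α)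

/-- Unfolding lemma for `eigenprojection`. [folklore] -/
theorem eigenprojection_apply (f : Module.End K V) (α : K) (x : V) :
    eigenprojection f α x =
      (⨆ m : ℕ, LinearMap.ker ((f - α • 1) ^ m)).projection
        (⨅ m : ℕ, LinearMap.range ((f - α • 1) ^ m)) (isCompl_iSup_ker_iInf_range f α) x :=
  rfl

/-- `e_{f,α}` is the identity on the generalised `α`-eigenspace. [folklore] -/
theorem eigenprojection_apply_of_mem {f : Module.End K V} {α : K} {x : V}
    (hx : x ∈ f.maxGenEigenspace α) : eigenprojection f α x = x := by
  rw [← iSup_ker_pow_eq_maxGenEigenspace] at hx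
  exact Submodule.projection_apply_of_mem_left _ hx

/-- `e_{f,α}` fixes the `α`-eigenvectors of `f`. [folklore] -/
theorem eigenprojection_apply_of_apply_eq_smul {f : Module.End K V} {α : K} {v : V}
    (hv : f v = α • v) : eigenprojection f α v = v :=
  eigenprojection_apply_of_mem <| by
    rw [Module.End.mem_maxGenEigenspace]
    exact ⟨1, by simp [hv]⟩

/-- `e_{f,α}` kills the Fitting complement `⋂ₘ range (f − α)ᵐ`. [folklore] -/
theorem eigenprojection_apply_of_mem_iInf_range {f : Module.End K V} {α : K} {x : V}
    (hx : x ∈ ⨅ m : ℕ, LinearMap.range ((f - α • 1) ^ m)) : eigenprojection f α x = 0 :=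
  Submodule.projection_apply_of_mem_right _ hx

/-- `e_{f,α}` kills the eigenvectors of `f` for eigenvalues `β ≠ α` (they lie in every
`range (f − α)ᵐ`).  With `eigenprojection_apply_of_apply_eq_smul` this computes `e_{f,α}` on an
eigenbasis of a diagonalisable `f`. [folklore] -/
theorem eigenprojection_apply_of_apply_eq_smul_of_ne {f : Module.End K V} {α β : K} {v : V}
    (hv : f v = β • v) (hne : β ≠ α) : eigenprojection f α v = 0 := by
  apply eigenprojection_apply_of_mem_iInf_range
  have h1 : (f - α • 1) v = (β - α) • v := by
    rw [LinearMap.sub_apply, hv, LinearMap.smul_apply, Module.End.one_apply, sub_smul]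
  have hm : ∀ m : ℕ, ((f - α • 1) ^ m) v = (β - α) ^ m • v := by
    intro m
    induction m with
    | zero => simp
    | succ m ih =>
      rw [pow_succ, Module.End.mul_apply, h1, map_smul, ih, smul_smul, pow_succ']
  rw [Submodule.mem_iInf]
  intro m
  refine LinearMap.mem_range.2 ⟨((β - α)⁻¹ ^ m) • v, ?_⟩
  rw [map_smul, hm, smul_smul, ← mul_pow, inv_mul_cancel₀ (sub_ne_zero.2 hne), one_pow, one_smul]

/-- The range of `e_{f,α}` is the generalised `α`-eigenspace. [folklore] -/
theorem range_eigenprojection (f : Module.End K V) (α : K) :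
    LinearMap.range (eigenprojection f α) = f.maxGenEigenspace α := by
  rw [eigenprojection, Submodule.range_projection, iSup_ker_pow_eq_maxGenEigenspace]

/-- The kernel of `e_{f,α}` is the Fitting complement `⋂ₘ range (f − α)ᵐ`. [folklore] -/
theorem ker_eigenprojection (f : Module.End K V) (α : K) :
    LinearMap.ker (eigenprojection f α) = ⨅ m : ℕ, LinearMap.range ((f - α • 1) ^ m) := by
  rw [eigenprojection, Submodule.ker_projection]

/-- `e_{f,α}` is idempotent. [folklore] -/
theorem isIdempotentElem_eigenprojection (f : Module.End K V) (α : K) :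
    IsIdempotentElem (eigenprojection f α) :=
  Submodule.isIdempotentElem_projection _

/-- `e_{f,α} = 0` iff `α` is not an eigenvalue of `f` (the generalised eigenspace is `0`).
[folklore] -/
theorem eigenprojection_eq_zero_iff (f : Module.End K V) (α : K) :
    eigenprojection f α = 0 ↔ f.maxGenEigenspace α = ⊥ := by
  rw [← range_eigenprojection, LinearMap.range_eq_bot]

/-- `e_{f,α} ≠ 0` iff `α` is an eigenvalue of `f` (Mathlib `Module.End.HasEigenvalue`; a
generalised eigenvalue is an eigenvalue, `hasUnifEigenvalue_iff_hasUnifEigenvalue_one`).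
[folklore] -/
theorem eigenprojection_ne_zero_iff (f : Module.End K V) (α : K) :
    eigenprojection f α ≠ 0 ↔ f.HasEigenvalue α := by
  rw [Ne, eigenprojection_eq_zero_iff]
  change f.HasUnifEigenvalue α ⊤ ↔ f.HasUnifEigenvalue α 1
  exact Module.End.hasUnifEigenvalue_iff_hasUnifEigenvalue_one ENat.top_pos

omit [FiniteDimensional K V] in
/-- `(f − α)ᵐ` commutes with `f`. [folklore] -/
theorem pow_sub_smul_one_mul_comm (f : Module.End K V) (α : K) (m : ℕ) :
    (f - α • 1) ^ m * f = f * (f - α • 1) ^ m :=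
  (((Commute.refl f).sub_left ((Commute.one_left f).smul_left α)).pow_left m).eq

/-- **`e_{f,α}` is `f`-equivariant**: it commutes with `f` (`f` preserves both Fitting summands).
[cite: Thorne2012, §2 (before Def. 2.1)] -/
theorem eigenprojection_mul_comm (f : Module.End K V) (α : K) :
    eigenprojection f α * f = f * eigenprojection f α := by
  -- `f` preserves the generalised eigenspace ...
  have hK : ∀ y ∈ (⨆ m : ℕ, LinearMap.ker ((f - α • 1) ^ m)),
      f y ∈ (⨆ m : ℕ, LinearMap.ker ((f - α • 1) ^ m)) := by
    intro y hy
    rw [iSup_ker_pow_eq_maxGenEigenspace, Module.End.mem_maxGenEigenspace] at hy ⊢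
    obtain ⟨m, hm⟩ := hy
    refine ⟨m, ?_⟩
    rw [← Module.End.mul_apply, pow_sub_smul_one_mul_comm, Module.End.mul_apply, hm, map_zero]
  -- ... and the Fitting complement
  have hR : ∀ z ∈ (⨅ m : ℕ, LinearMap.range ((f - α • 1) ^ m)),
      f z ∈ (⨅ m : ℕ, LinearMap.range ((f - α • 1) ^ m)) := by
    intro z hz
    rw [Submodule.mem_iInf] at hz ⊢
    intro m
    obtain ⟨y, hy⟩ := LinearMap.mem_range.1 (hz m)
    refine LinearMap.mem_range.2 ⟨f y, ?_⟩
    rw [← Module.End.mul_apply, pow_sub_smul_one_mul_comm, Module.End.mul_apply, hy]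
  refine LinearMap.ext fun x => ?_
  obtain ⟨y, z, hyz, -⟩ :=
    Submodule.existsUnique_add_of_isCompl (isCompl_iSup_ker_iInf_range f α) x
  have e1 : eigenprojection f α (f y) = f y :=
    Submodule.projection_apply_of_mem_left _ (hK y y.2)
  have e2 : eigenprojection f α (f z) = 0 :=
    Submodule.projection_apply_of_mem_right _ (hR z z.2)
  have e3 : eigenprojection f α y = y := Submodule.projection_apply_left _ y
  have e4 : eigenprojection f α z = 0 := Submodule.projection_apply_right _ z
  rw [Module.End.mul_apply, Module.End.mul_apply, ← hyz]
  simp only [map_add]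
  rw [e1, e2, e3, e4, map_zero]

end Eigenprojection

section EigenprojectionMatrix

variable {K : Type*} [Field K] {ι : Type*} [Fintype ι] [DecidableEq ι]

/-- **`e_{A,α}` for a square matrix `A`** acting on column vectors `ι → K` (`Matrix.toLin'`):
the matrix (`LinearMap.toMatrix'`) of `eigenprojection (Matrix.toLin' A) α`.
[cite: Thorne2012, §2 (before Def. 2.1)] -/
def eigenprojectionMatrix (A : Matrix ι ι K) (α : K) : Matrix ι ι K :=
  LinearMap.toMatrix' (eigenprojection (Matrix.toLin' A) α)

/-- Unfolding lemma for `eigenprojectionMatrix`. [folklore] -/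
theorem toLin'_eigenprojectionMatrix (A : Matrix ι ι K) (α : K) :
    Matrix.toLin' (eigenprojectionMatrix A α) = eigenprojection (Matrix.toLin' A) α := by
  rw [eigenprojectionMatrix, Matrix.toLin'_toMatrix']

/-- `e_{A,α}` commutes with `A`. [folklore] -/
theorem eigenprojectionMatrix_mul_comm (A : Matrix ι ι K) (α : K) :
    eigenprojectionMatrix A α * A = A * eigenprojectionMatrix A α := by
  have h := congrArg LinearMap.toMatrix' (eigenprojection_mul_comm (Matrix.toLin' A) α)
  rwa [LinearMap.toMatrix'_mul, LinearMap.toMatrix'_mul, LinearMap.toMatrix'_toLin'] at h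

/-- `e_{A,α}` is an idempotent matrix. [folklore] -/
theorem eigenprojectionMatrix_mul_self (A : Matrix ι ι K) (α : K) :
    eigenprojectionMatrix A α * eigenprojectionMatrix A α = eigenprojectionMatrix A α := by
  have h := congrArg LinearMap.toMatrix' (isIdempotentElem_eigenprojection (Matrix.toLin' A) α).eq
  rwa [LinearMap.toMatrix'_mul] at h

/-- In clause (iv) of adequacy the scalar `α` is automatically an eigenvalue: if
`tr(e_{A,α} w) ≠ 0` for some `w` then `e_{A,α} ≠ 0`, i.e. `α` is an eigenvalue of `A`.
[folklore] -/
theorem hasEigenvalue_of_trace_eigenprojectionMatrix_mul_ne_zero {A w : Matrix ι ι K} {α : K}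
    (h : (eigenprojectionMatrix A α * w).trace ≠ 0) :
    Module.End.HasEigenvalue (Matrix.toLin' A) α := by
  rw [← eigenprojection_ne_zero_iff]
  intro h0
  apply h
  rw [eigenprojectionMatrix, h0, map_zero, Matrix.zero_mul, Matrix.trace_zero]

end EigenprojectionMatrix

/-! ### Adequate subgroups -/

section Subgroup

variable {k : Type u} [Field k] {n : ℕ}

/-- **`H ≤ GL_n(k)` is adequate** in the sense of Thorne 2012, Def. 2.3 (clauses verbatim; the
last clause in the amended form of the Guralnick–Herzig–Taylor–Thorne appendix, Lemma 1(2): the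
element is taken semisimple, "i.e. of order prime to `l`").  With `p = ringChar k`, `ad⁰` the
trace-zero matrices under `h • M = h M h⁻¹` (`Subgroup.adZeroRep H`) and `e_{h,α}` the
`h`-equivariant projection onto the generalised `α`-eigenspace (`eigenprojectionMatrix`):
* `addMonoidHom_eq_zero` — (i) `H¹(H, k) = 0` (trivial action; `H¹ = Hom(H, k)`): every additive
  homomorphism `H → k` vanishes;
* `invariants_eq_bot` — (ii) `H⁰(H, ad⁰) = (ad⁰)^H = 0`;
* `cocycles₁_le_coboundaries₁` — (iii) `H¹(H, ad⁰) = 0`: every inhomogeneous `1`-cocycle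
  `H → ad⁰` is a `1`-coboundary (Mathlib `groupCohomology.cocycles₁`, `coboundaries₁`);
* `exists_trace_eigenprojection_ne_zero` — (iv) for every simple `k[H]`-submodule `W ⊆ ad⁰` (an
  atom of the lattice of subrepresentations) there exist `h ∈ H` of order prime to `p`, `α ∈ k`
  and `w ∈ W` with `tr(e_{h,α} w) ≠ 0` ("there exists a [semisimple] element `g ∈ G` with an
  eigenvalue `α` such that `tr e_{g,α} W ≠ 0`"; `α` is then automatically an eigenvalue of `h`).
Thorne states the definition for `k` finite of characteristic `l`, `G` acting absolutely
irreducibly on `V`, and `k` containing all eigenvalues of all elements of `G`; none of these is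
made a clause (module docstring, "Design").  Declared as
`….GaloisRepresentations.Subgroup.IsThorneAdequate` (topic namespace, not Mathlib's `Subgroup`).
[cite: Thorne2012, Def. 2.3 (with appendix by Guralnick–Herzig–Taylor–Thorne, Lemma 1)] -/
structure Subgroup.IsThorneAdequate (H : Subgroup (GL (Fin n) k)) : Prop where
  /-- (i) `H¹(H, k) = 0` for the trivial action: `Hom(H, k) = 0`. -/
  addMonoidHom_eq_zero : ∀ f : Additive H →+ k, f = 0
  /-- (ii) `H⁰(H, ad⁰) = 0`. -/
  invariants_eq_bot : (Subgroup.adZeroRep H).invariants = ⊥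
  /-- (iii) `H¹(H, ad⁰) = 0`. -/
  cocycles₁_le_coboundaries₁ :
    groupCohomology.cocycles₁ (Rep.of (Subgroup.adZeroRep H)) ≤
      groupCohomology.coboundaries₁ (Rep.of (Subgroup.adZeroRep H))
  /-- (iv) every simple `k[H]`-submodule `W ⊆ ad⁰` satisfies `tr(e_{h,α} W) ≠ 0` for some `h ∈ H`
  of order prime to `p` and some `α ∈ k`. -/
  exists_trace_eigenprojection_ne_zero :
    ∀ W : Subrepresentation (Subgroup.adZeroRep H), IsAtom W →
      ∃ h : H, (orderOf (h : GL (Fin n) k)).Coprime (ringChar k) ∧ ∃ α : k, ∃ w ∈ W,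
        (eigenprojectionMatrix (((h : GL (Fin n) k)) : Matrix (Fin n) (Fin n) k) α *
          (w : Matrix (Fin n) (Fin n) k)).trace ≠ 0

/-- A checkable form of "order prime to `p`" in clause (iv): if `g ^ m = 1` with `m` prime to
`p = ringChar k` then the order of `g` is prime to `p`. [folklore] -/
theorem coprime_orderOf_of_pow_eq_one {g : GL (Fin n) k} {m : ℕ} (hm : m.Coprime (ringChar k))
    (hg : g ^ m = 1) : (orderOf g).Coprime (ringChar k) :=
  Nat.Coprime.coprime_dvd_left (orderOf_dvd_of_pow_eq_one hg) hm

namespace Subgroup.IsThorneAdequate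

variable {H : Subgroup (GL (Fin n) k)}

/-- Clause (i) in Mathlib's group cohomology: for an adequate `H`, `H¹(H, k)`
(`groupCohomology.H1` of the trivial representation `Rep.trivial k H k`) is zero, by Mathlib's
`H¹(G, A) ≅ Hom(G, A)` for trivial `A` (`groupCohomology.H1IsoOfIsTrivial`). [folklore] -/
theorem subsingleton_H1_trivial (hH : Subgroup.IsThorneAdequate H) :
    Subsingleton (groupCohomology.H1 (Rep.trivial k H k)) := by
  haveI : Subsingleton (Additive H →+ k) :=
    ⟨fun f g => by rw [hH.addMonoidHom_eq_zero f, hH.addMonoidHom_eq_zero g]⟩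
  exact (groupCohomology.H1IsoOfIsTrivial (Rep.trivial k H k)).toLinearEquiv.injective.subsingleton

/-- Clause (iii) in Mathlib's group cohomology: for an adequate `H`, `H¹(H, ad⁰)`
(`groupCohomology.H1`) is zero (every class is represented by a cocycle, `H1_induction_on`, and a
cocycle maps to `0` iff it is a coboundary, `H1π_eq_zero_iff`). [folklore] -/
theorem subsingleton_H1 (hH : Subgroup.IsThorneAdequate H) :
    Subsingleton (groupCohomology.H1 (Rep.of (Subgroup.adZeroRep H))) := by
  refine ⟨fun x y => ?_⟩
  have h0 : ∀ z : groupCohomology.H1 (Rep.of (Subgroup.adZeroRep H)), z = 0 := by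
    intro z
    induction z using groupCohomology.H1_induction_on with
    | h f =>
      rw [groupCohomology.H1π_eq_zero_iff]
      exact hH.cocycles₁_le_coboundaries₁ f.2
  rw [h0 x, h0 y]

/-- Clause (ii) elementwise: an `H`-invariant trace-zero matrix is `0`. [folklore] -/
theorem eq_zero_of_forall_apply_eq (hH : Subgroup.IsThorneAdequate H)
    {M : (adZero (Fin n) k).toSubmodule} (hM : ∀ h : H, Subgroup.adZeroRep H h M = M) :
    M = 0 := by
  have : M ∈ (Subgroup.adZeroRep H).invariants := (Representation.mem_invariants _ M).2 hM
  rw [hH.invariants_eq_bot] at this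
  exact (Submodule.mem_bot k).1 this

/-- Clause (i) multiplicatively: every homomorphism from an adequate `H` to the additive group of
`k` (written `Multiplicative k`) is trivial. [folklore] -/
theorem monoidHom_eq_one (hH : Subgroup.IsThorneAdequate H) (f : H →* Multiplicative k) :
    f = 1 := by
  have h := hH.addMonoidHom_eq_zero (MonoidHom.toAdditiveLeft f)
  ext x
  have hx := DFunLike.congr_fun h (Additive.ofMul x)
  simpa using hx

end Subgroup.IsThorneAdequate

/-- If `n = 0` in `k` and `n ≥ 1`, the identity matrix is a non-zero `H`-invariant element of
`ad⁰`, so `H⁰(H, ad⁰) ≠ 0` for every `H ≤ GL_n(k)`. [folklore] -/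
theorem Subgroup.adZeroRep_invariants_ne_bot (H : Subgroup (GL (Fin n) k)) (hn : (n : k) = 0)
    (hn0 : 0 < n) : (Subgroup.adZeroRep H).invariants ≠ ⊥ := by
  intro hbot
  have h1 : (1 : Matrix (Fin n) (Fin n) k) ∈ (adZero (Fin n) k).toSubmodule := by
    rw [mem_adZero_toSubmodule_iff, Matrix.trace_one, Fintype.card_fin, hn]
  have hfix : ∀ h : H, Subgroup.adZeroRep H h ⟨1, h1⟩ = ⟨1, h1⟩ := by
    intro h
    ext1
    change (((h : GL (Fin n) k)) : Matrix (Fin n) (Fin n) k) * 1 *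
        ((((h : GL (Fin n) k))⁻¹ : GL (Fin n) k) : Matrix (Fin n) (Fin n) k) = 1
    rw [Matrix.mul_one, Units.mul_inv]
  have hmem : (⟨1, h1⟩ : (adZero (Fin n) k).toSubmodule) ∈ (Subgroup.adZeroRep H).invariants :=
    (Representation.mem_invariants _ _).2 hfix
  rw [hbot] at hmem
  have h0 : (1 : Matrix (Fin n) (Fin n) k) = 0 := congrArg Subtype.val ((Submodule.mem_bot k).1 hmem)
  haveI : Nonempty (Fin n) := ⟨⟨0, hn0⟩⟩
  exact one_ne_zero h0

/-- **If `p ∣ n` (`n ≥ 1`), no subgroup of `GL_n(k)` is adequate in the sense of Def. 2.3**: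
`ad⁰` contains the scalar matrices, contradicting (ii).  (This is why Guralnick–Herzig–Tiep list
"`p` does not divide `dim V`" as the first condition of Thorne's 2012 notion; Thorne's later
extended notion drops it.) [cite: GuralnickHerzigTiep2017, §1] -/
theorem Subgroup.not_isThorneAdequate_of_natCast_eq_zero (H : Subgroup (GL (Fin n) k))
    (hn : (n : k) = 0) (hn0 : 0 < n) : ¬ Subgroup.IsThorneAdequate H := fun hH =>
  Subgroup.adZeroRep_invariants_ne_bot H hn hn0 hH.invariants_eq_bot

end Subgroup

/-! ### Dot-form for framed representations -/

section Framed

variable {G : Type*} [Group G] [TopologicalSpace G] {k : Type u} [Field k] [TopologicalSpace k]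
  {n : ℕ}

/-- A framed representation `ρ : G →ₜ* GL_n(k)` **has adequate image** if the subgroup
`ρ(G) ≤ GL_n(k)` is adequate (`Subgroup.IsThorneAdequate`).  Thorne's automorphy lifting theorems
assume "`ρ̄` is absolutely irreducible and `ρ̄(G_{F(ζ_l)}) ⊂ GL_n(k)` is adequate", i.e.
`HasAdequateImage` of the restriction of the residual representation `ρ̄` to `G_{F(ζ_l)}`.
[cite: Thorne2012, Thm. 7.1 (also Thms. 9.1, 10.1, 10.2)] -/
def FramedRep.HasAdequateImage (ρ : FramedRep G k n) : Prop :=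
  Subgroup.IsThorneAdequate ρ.toMonoidHom.range

/-- Unfolding lemma for `FramedRep.HasAdequateImage`. [folklore] -/
theorem FramedRep.hasAdequateImage_iff (ρ : FramedRep G k n) :
    ρ.HasAdequateImage ↔ Subgroup.IsThorneAdequate ρ.toMonoidHom.range :=
  Iff.rfl

end Framed

end Literature.NumberTheory.GaloisRepresentations
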